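import Mathlib

/-!
# FoolingMeasure (stmt-PneNP-19727) — round-2 crux ideas, seat 1, gen 5

First lemmas / typed targets for the three g5 idea cards, stated inside the NORMAL CYCLE SYSTEM
universe (seat 2, `Cruxes/FoolingMeasure/NormalCycleSystems.lean`; re-declared minimally here so the
file is self-contained):

* `completion-entropy`  — `StrongNormalAbundance`, `RulerCompletionBound`, `BobFibreBound`;
* `slip-exposure-count` — PROVED: `inc_sum_telescope`, `zmod3_eq_of_add_ne_zero`,
  `square_of_cycle_not_threeColourable` (the cycle-square `C_n²`, `n ≡ 1 (mod 3)`, has no proper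
  `ZMod 3`-colouring: the slip calculus in its degenerate case); typed: `SlipRigidityInequality`;
* `seam-shield` — PROVED: `seamShield_holds : SeamShield` (with `seamColour_foreign`,
  `seamColour_own`, `seamArcLemma_holds`, `shift3_injective`): in a normal system, a ruler with one
  seam edge inside the cut `B` and one not inside yields proper 3-colourings of Alice's graph and of
  Bob's graph that AGREE on every vertex set `T` off the arc between the two seams.

The increment ("τ") calculus and the normal-system universe are seat 2's (`NormalCycleSystems.lean`,
`R8-HYBRIDS.md` §2); this file re-declares the minimum so that it is self-contained.

FRONTIER restricted-model rung (AEA / cut rectangles); nothing here moves `P ≠ NP`.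
-/

set_option linter.dupNamespace false

namespace Summit.PneNP.PneNP.Cruxes.FoolingMeasure.IdeasR2g5

open Finset

/-! ## Normal cycle systems (minimal mirror of seat 2's definitions) -/

/-- `t` rulers on `n = 3q+1` vertices: `P k v` is the position of vertex `v` along ruler `k`. -/
abbrev Rulers (q t : ℕ) := Fin t → Equiv.Perm (Fin (3 * q + 1))

variable {q t : ℕ}

/-- successor of `v` along ruler `k`. -/
def succ (P : Rulers q t) (k : Fin t) (v : Fin (3 * q + 1)) : Fin (3 * q + 1) :=
  (P k).symm (P k v + 1)

/-- NORMALITY: every edge of cycle `k`, read along any other ruler `i`, jumps forward by `≡ 2 (mod 3)`. -/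
def IsNormal (P : Rulers q t) : Prop :=
  ∀ i k : Fin t, i ≠ k → ∀ v, ((P i (succ P k v) - P i v).val) % 3 = 2

/-- the edge set: union of the `t` Hamiltonian cycles. -/
def edges (P : Rulers q t) : Finset (Sym2 (Fin (3 * q + 1))) :=
  univ.biUnion fun k => univ.image fun v => s(v, succ P k v)

open Classical in
/-- number of (labelled) normal systems. -/
noncomputable def normalCount (q t : ℕ) : ℕ :=
  (univ.filter fun P : Rulers q t => IsNormal P).card

/-! ## Card 1 — completion entropy -/

/-- STRONG abundance, typed at the labelled first-moment rate `t · log₂ n! − O(n)`: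
the number of normal `t`-systems is at least `(n!)^t · 2^{-κ n}`.  (Seat 2's `NormalAbundance`
`(n!)^{t-1-ε} ≤ normalCount` is too weak for the entropy argument below by a factor `n!^{1+ε}`.) -/
def StrongNormalAbundance (t : ℕ) : Prop :=
  ∃ κ q₀ : ℕ, ∀ q ≥ q₀, (Nat.factorial (3 * q + 1)) ^ t ≤ 2 ^ (κ * (3 * q + 1)) * normalCount q t

/-- edges of the Hamiltonian cycle defined by one ruler `σ` (as a position map). -/
def rulerEdges {n : ℕ} [NeZero n] (σ : Equiv.Perm (Fin n)) : Finset (Sym2 (Fin n)) :=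
  univ.image fun v => s(v, σ.symm (σ v + 1))

open Classical in
/-- COMPLETION BOUND (one ruler): the number of cyclic position maps whose cycle contains a
prescribed edge set `M` (`|M| = m ≤ n-1`) is at most `n · 2^m · (n-1-m)!` — `M` must be a linear
forest with `n-m` components, arranged cyclically in `(n-m-1)!` orders, `≤ 2^m` orientations,
`n` rotations.  This is the placement/high-resolution input: a Bob side with `e(β)` edges is
contained in few systems. -/
def RulerCompletionBound : Prop :=
  ∀ (n : ℕ) [NeZero n] (M : Finset (Sym2 (Fin n))), M.card + 1 ≤ n →
    (univ.filter fun σ : Equiv.Perm (Fin n) => M ⊆ rulerEdges σ).card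
      ≤ n * 2 ^ M.card * Nat.factorial (n - 1 - M.card)

open Classical in
/-- BOB FIBRE BOUND (all rulers): summing the one-ruler bound over the `≤ t^{e(β)}` assignments of
the edges of `β` to rulers, the number of ruler systems whose edge set induces exactly `β` on `B`
is at most `t^{e(β)} · (n · 2^{e(β)})^t · ((n-1-⌈e(β)/t⌉)!)·(n-1)!^{t-1}`; we record the cruder
consequence actually used (each factor `(n-1-m_k)! ≤ (n-1)!/(n-1-m_k choose …)` replaced by
`n!/q^{m_k}` for `m_k ≤ 2q`). -/
def BobFibreBound (t : ℕ) : Prop :=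
  ∀ (q : ℕ) (B : Finset (Fin (3 * q + 1))) (β : Finset (Sym2 (Fin (3 * q + 1)))),
    β.card ≤ 2 * q →
    ((univ.filter fun P : Rulers q t =>
        (edges P).filter (fun e => ∀ v ∈ e, v ∈ B) = β).card : ℝ)
      ≤ (2 * t : ℝ) ^ β.card * (3 * q + 1 : ℝ) ^ t * (Nat.factorial (3 * q + 1) : ℝ) ^ t
          / (q : ℝ) ^ β.card

open Classical in
/-- The entropy consequence (E): under strong abundance, for the uniform measure on normal
`t`-systems, a Bob side with `e(β) ≥ (1/2+ε)·n` edges has mass `≤ 2^{-(n/2)·log₂ n - C·n}`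
eventually — min-entropy of `G_B` at the atom scale, with NO placement randomness beyond the
rulers themselves. -/
def BobMinEntropy (t : ℕ) (ε : ℝ) : Prop :=
  ∀ C : ℕ, ∃ q₀ : ℕ, ∀ q ≥ q₀, ∀ (B : Finset (Fin (3 * q + 1))) (β : Finset (Sym2 (Fin (3 * q + 1)))),
    (1 / 2 + ε) * (3 * q + 1 : ℝ) ≤ β.card → β.card ≤ 2 * q →
    ((univ.filter fun P : Rulers q t =>
        IsNormal P ∧ (edges P).filter (fun e => ∀ v ∈ e, v ∈ B) = β).card : ℝ)
      ≤ (2 : ℝ) ^ (-((3 * q + 1 : ℝ) / 2 * Real.logb 2 (3 * q + 1)) - C * (3 * q + 1)) * normalCount q t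

/-- the card's first implication (pure counting once the two bounds are in hand). -/
def EntropyFromAbundance (t : ℕ) : Prop :=
  StrongNormalAbundance t → BobFibreBound t → ∀ ε : ℝ, 0 < ε → BobMinEntropy t ε

/-! ## Card 2 — slip calculus -/

section slips

open Fin.NatCast Fin.CommRing

variable {n : ℕ} [NeZero n] {α : Type*}

/-- increment of a `ZMod 3`-colouring along a ruler (`σ p` = vertex at position `p`). -/
def inc (σ : Fin n → α) (c : α → ZMod 3) (p : Fin n) : ZMod 3 := c (σ (p + 1)) - c (σ p)

/-- telescoping: the colour difference across `J` ruler steps is the sum of the increments. -/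
theorem inc_sum_telescope (σ : Fin n → α) (c : α → ZMod 3) (p : Fin n) (J : ℕ) :
    c (σ (p + (J : Fin n))) - c (σ p) = ∑ i ∈ range J, inc σ c (p + (i : Fin n)) := by
  induction J with
  | zero => simp
  | succ J ih =>
    rw [sum_range_succ, ← ih]
    simp only [inc, Nat.cast_succ, ← add_assoc]
    ring

/-- in `ZMod 3`, two non-zero elements with non-zero sum are equal. -/
theorem zmod3_eq_of_add_ne_zero : ∀ x y : ZMod 3, x ≠ 0 → y ≠ 0 → x + y ≠ 0 → y = x := by decide

/-- the increments of a proper colouring along a ruler sum to zero around the cycle. -/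
theorem sum_inc_eq_zero (σ : Fin n → α) (c : α → ZMod 3) : ∑ p, inc σ c p = 0 := by
  simp only [inc, sum_sub_distrib]
  rw [sub_eq_zero]
  exact Fintype.sum_equiv (Equiv.addRight 1) _ _ (fun _ => rfl)

/-- SLIP CALCULUS, degenerate case: along a ruler of length `n = 3q+1`, a `ZMod 3`-colouring that is
proper on consecutive pairs AND on all distance-2 pairs does not exist (the increments are forced
constant `a ≠ 0`, and `n • a = a ≠ 0` contradicts the zero sum).  Consequences used on the card:
the cycle-square `C_n²` is not 3-colourable; no normal system can have a ruler square inside its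
edge set; `|D_k| = 2`-type colourings are impossible. -/
theorem square_of_cycle_not_threeColourable (q : ℕ) (σ : Fin (3 * q + 1) → α) (c : α → ZMod 3)
    (h1 : ∀ p, c (σ (p + 1)) ≠ c (σ p)) (h2 : ∀ p, c (σ (p + 2)) ≠ c (σ p)) : False := by
  -- consecutive increments are equal
  have hstep : ∀ p : Fin (3 * q + 1), inc σ c (p + 1) = inc σ c p := by
    intro p
    have hsum : inc σ c p + inc σ c (p + 1) ≠ 0 := by
      have : c (σ (p + 2)) - c (σ p) = inc σ c p + inc σ c (p + 1) := by
        simp only [inc]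
        rw [show p + 2 = p + 1 + 1 from by rw [add_assoc, one_add_one_eq_two]]
        ring
      rw [← this, sub_ne_zero]
      exact h2 p
    exact zmod3_eq_of_add_ne_zero _ _ (sub_ne_zero.mpr (h1 p)) (sub_ne_zero.mpr (h1 (p + 1))) hsum
  -- hence all increments equal `inc 0`
  have hconst : ∀ m : ℕ, inc σ c (m : Fin (3 * q + 1)) = inc σ c 0 := by
    intro m
    induction m with
    | zero => simp
    | succ m ih => rw [Nat.cast_succ, hstep, ih]
  have hall : ∀ p : Fin (3 * q + 1), inc σ c p = inc σ c 0 := by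
    intro p
    have := hconst p.val
    rwa [Fin.cast_val_eq_self] at this
  -- sum of increments: zero, but also `(3q+1) • inc 0 = inc 0 ≠ 0`
  have hz := sum_inc_eq_zero σ c
  rw [Finset.sum_congr rfl (fun p _ => hall p), sum_const, card_univ, Fintype.card_fin,
    nsmul_eq_mul] at hz
  push_cast at hz
  rw [show (3 : ZMod 3) = 0 from rfl, zero_mul, zero_add, one_mul] at hz
  exact (sub_ne_zero.mpr (h1 0)) hz

/-- window condition of the slip calculus: for a proper colouring, if `(σ p, σ (p+J))` is an edge
then the increments over the window do not sum to zero; with `inc = 1 + [slip]` and `J ≡ 2 (mod 3)`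
this reads `#slips in the window ≢ 1 (mod 3)`. -/
theorem window_sum_ne_zero (σ : Fin n → α) (c : α → ZMod 3) (p : Fin n) (J : ℕ)
    (hedge : c (σ (p + (J : Fin n))) ≠ c (σ p)) : ∑ i ∈ range J, inc σ c (p + (i : Fin n)) ≠ 0 := by
  rw [← inc_sum_telescope]; exact sub_ne_zero.mpr hedge

end slips

open Classical in
/-- RIGIDITY AS A PAIR COUNT (the card's crux): proper `3`-colourings of normal `t`-systems,
`t ≥ 3`, are exponentially rare ON AVERAGE — the number of pairs (system, proper colouring with
vertex `0` coloured `0`) is at most `θ^n` times the number of systems for some `θ < 1`, eventually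
(no hand-picked constant, checklist 4c(iv)).  By Markov this gives seat 2's `NormalMostlyRigid`; the
first moment of seat 2's τ-calculus predicts the true rate `3·(2/3)^{(t-1)n}·2^n / …`, i.e. `(8/9+o(1))^n`
at `t = 3`. -/
def SlipRigidityInequality (t : ℕ) : Prop :=
  ∃ θ : ℝ, 0 < θ ∧ θ < 1 ∧ ∃ q₀ : ℕ, ∀ q ≥ q₀,
    ((univ.filter fun Pc : Rulers q t × (Fin (3 * q + 1) → Fin 3) =>
          IsNormal Pc.1 ∧ Pc.2 0 = 0 ∧ ∀ e ∈ edges Pc.1, ∀ u ∈ e, ∀ v ∈ e, u ≠ v → Pc.2 u ≠ Pc.2 v).card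
        : ℝ)
      ≤ θ ^ (3 * q + 1) * normalCount q t

/-! ## Card 3 — seam shield -/

/-- seam colouring of ruler `σ` with seam at position `s`: colour = (position − s) mod 3, positions
read cyclically starting from the seam. -/
def seamColour {n : ℕ} [NeZero n] (σ : Equiv.Perm (Fin n)) (s : Fin n) (v : Fin n) : Fin 3 :=
  ⟨(σ v - s).val % 3, Nat.mod_lt _ (by norm_num)⟩

/-- `v` lies on the ruler arc from position `s` (inclusive) to position `s'` (exclusive). -/
def onArc {n : ℕ} [NeZero n] (σ : Equiv.Perm (Fin n)) (s s' v : Fin n) : Prop :=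
  (σ v - s).val < (s' - s).val

/-- SEAM ARC LEMMA: off the arc between two seams, the two seam colourings differ by the constant
`(s' - s) mod 3`. -/
def SeamArcLemma : Prop :=
  ∀ (n : ℕ) [NeZero n] (σ : Equiv.Perm (Fin n)) (s s' v : Fin n), ¬ onArc σ s s' v →
    (seamColour σ s v).val = ((seamColour σ s' v).val + (s' - s).val) % 3


/-- proof of the seam arc lemma (pure `Fin` arithmetic). -/
theorem seamArcLemma_holds : SeamArcLemma := by
  intro n _ σ s s' v hv
  simp only [onArc, not_lt] at hv
  simp only [seamColour]
  have hab : σ v - s = (σ v - s') + (s' - s) := (sub_add_sub_cancel (σ v) s' s).symm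
  rw [hab] at hv ⊢
  rw [Fin.val_add_eq_ite] at hv ⊢
  have ha := (σ v - s').isLt
  have hb := (s' - s).isLt
  split_ifs at hv ⊢ with h
  · omega
  · omega

/-- Bob's graph (edges inside `B`) and Alice's graph (edges meeting the complement). -/
def bobGraph (P : Rulers q t) (B : Finset (Fin (3 * q + 1))) : SimpleGraph (Fin (3 * q + 1)) :=
  SimpleGraph.fromEdgeSet (((edges P).filter fun e => ∀ v ∈ e, v ∈ B) : Set (Sym2 (Fin (3 * q + 1))))

def aliceGraph (P : Rulers q t) (B : Finset (Fin (3 * q + 1))) : SimpleGraph (Fin (3 * q + 1)) :=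
  SimpleGraph.fromEdgeSet (((edges P).filter fun e => ∃ v ∈ e, v ∉ B) : Set (Sym2 (Fin (3 * q + 1))))

/-- SEAM SHIELD (typed target of card 3): in a normal system, if some ruler `k` has a seam position
`s` whose cycle edge lies inside `B` and a seam position `s'` whose cycle edge does not, with no
vertex of `T` on the arc between them, then Alice's and Bob's one-sided colouring sets share a
pattern on `T` — so every interface rectangle through `T` separating `(S_A, S_B)` is unsound. -/
def SeamShield : Prop :=
  ∀ (q t : ℕ) (P : Rulers q t), IsNormal P → 2 ≤ t →
    ∀ (B T : Finset (Fin (3 * q + 1))) (k : Fin t) (s s' : Fin (3 * q + 1)),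
      -- the cycle-`k` edge entering position `s` lies inside `B`, the one entering `s'` does not
      ((P k).symm (s - 1) ∈ B ∧ (P k).symm s ∈ B) →
      ¬ ((P k).symm (s' - 1) ∈ B ∧ (P k).symm s' ∈ B) →
      (∀ v ∈ T, ¬ onArc (P k) s s' v) →
      ∃ χ : Fin (3 * q + 1) → Fin 3,
        (∃ cA : (aliceGraph P B).Coloring (Fin 3), ∀ v ∈ T, cA v = χ v) ∧
        (∃ cB : (bobGraph P B).Coloring (Fin 3), ∀ v ∈ T, cB v = χ v)

/-! ### Proof of the seam shield -/

/-- a seam colouring of ruler `k` is proper on every FOREIGN edge (this is where normality is used). -/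
theorem seamColour_foreign (P : Rulers q t) (hP : IsNormal P) {k j : Fin t} (hkj : k ≠ j)
    (s v : Fin (3 * q + 1)) :
    seamColour (P k) s v ≠ seamColour (P k) s (succ P j v) := by
  intro h
  have hv := congrArg Fin.val h
  simp only [seamColour] at hv
  have hn := hP k j hkj v
  have hab : P k (succ P j v) - s = (P k (succ P j v) - P k v) + (P k v - s) :=
    (sub_add_sub_cancel _ _ _).symm
  rw [hab, Fin.val_add_eq_ite] at hv
  have h1 := (P k (succ P j v) - P k v).isLt
  have h2 := (P k v - s).isLt
  split_ifs at hv <;> omega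

/-- a seam colouring is proper on every edge of its OWN cycle except the seam edge
(the edge occupying positions `s - 1, s`). -/
theorem seamColour_own (σ : Equiv.Perm (Fin (3 * q + 1))) (s v : Fin (3 * q + 1))
    (hv : σ v + 1 ≠ s) :
    seamColour σ s v ≠ seamColour σ s (σ.symm (σ v + 1)) := by
  intro h
  have hval := congrArg Fin.val h
  simp only [seamColour, Equiv.apply_symm_apply] at hval
  have hb : σ v + 1 - s = σ v - s + 1 := (sub_add_eq_add_sub _ _ _).symm
  rw [hb, Fin.val_add_eq_ite] at hval
  rcases Nat.eq_zero_or_pos q with hq | hq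
  · subst hq
    exact hv (Fin.ext (by have := (σ v + 1).isLt; have := s.isLt; omega))
  · have h1 : ((1 : Fin (3 * q + 1)) : ℕ) = 1 := by
      rw [Fin.val_one']; exact Nat.mod_eq_of_lt (by omega)
    rw [h1] at hval
    have hx := (σ v - s).isLt
    split_ifs at hval with hle
    · apply hv
      have h0 : σ v - s + 1 = 0 := by
        apply Fin.ext
        rw [Fin.val_add_eq_ite, h1, if_pos hle, Fin.val_zero]
        omega
      rw [← hb] at h0
      exact sub_eq_zero.mp h0
    · omega

/-- shifting colours by a constant (mod 3). -/
def shift3 (d : ℕ) (c : Fin 3) : Fin 3 := ⟨(c.val + d) % 3, Nat.mod_lt _ (by norm_num)⟩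

theorem shift3_injective (d : ℕ) : Function.Injective (shift3 d) := by
  intro a b h
  have h' := congrArg Fin.val h
  simp only [shift3] at h'
  apply Fin.ext
  have ha := a.isLt
  have hb := b.isLt
  omega

/-- THE SEAM SHIELD, proved. -/
theorem seamShield_holds : SeamShield := by
  intro q t P hP _ht B T k s s' hs hs' hT
  classical
  refine ⟨seamColour (P k) s, ?_, ?_⟩
  · -- Alice: the seam-`s` colouring is proper on every edge with an endpoint outside `B`,
    -- because its only improper edge is the seam edge, which lies inside `B`.
    refine ⟨SimpleGraph.Coloring.mk (seamColour (P k) s) ?_, fun v _ => rfl⟩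
    intro v w hadj
    rw [aliceGraph, SimpleGraph.fromEdgeSet_adj] at hadj
    obtain ⟨hmem, _hne⟩ := hadj
    rw [Finset.coe_filter] at hmem
    simp only [Set.mem_setOf_eq] at hmem
    obtain ⟨hE, hout⟩ := hmem
    have core : ∀ (j : Fin t) (u : Fin (3 * q + 1)), (∃ x ∈ s(u, succ P j u), x ∉ B) →
        seamColour (P k) s u ≠ seamColour (P k) s (succ P j u) := by
      intro j u hx
      by_cases hjk : j = k
      · rw [hjk] at hx ⊢
        show seamColour (P k) s u ≠ seamColour (P k) s ((P k).symm (P k u + 1))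
        apply seamColour_own
        intro heq
        have hu : u = (P k).symm (s - 1) := by
          rw [Equiv.eq_symm_apply]; exact eq_sub_of_add_eq heq
        have hsu : succ P k u = (P k).symm s := by
          show (P k).symm (P k u + 1) = _; rw [heq]
        obtain ⟨x, hx1, hx2⟩ := hx
        apply hx2
        rcases Sym2.mem_iff.mp hx1 with h | h
        · rw [h, hu]; exact hs.1
        · rw [h, hsu]; exact hs.2
      · exact seamColour_foreign P hP (Ne.symm hjk) s u
    simp only [edges, Finset.mem_biUnion, Finset.mem_univ, true_and, Finset.mem_image] at hE
    obtain ⟨j, u, hu⟩ := hE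
    rcases Sym2.eq_iff.mp hu with ⟨rfl, rfl⟩ | ⟨rfl, rfl⟩
    · exact core j _ hout
    · exact (core j _ (by rwa [Sym2.eq_swap] at hout)).symm
  · -- Bob: the seam-`s'` colouring is proper on every edge inside `B` (its improper edge is not
    -- inside `B`); shifted by `(s' - s) mod 3` it agrees with the seam-`s` colouring off the arc.
    refine ⟨SimpleGraph.Coloring.mk (fun v => shift3 (s' - s).val (seamColour (P k) s' v)) ?_, ?_⟩
    · intro v w hadj
      rw [bobGraph, SimpleGraph.fromEdgeSet_adj] at hadj
      obtain ⟨hmem, _hne⟩ := hadj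
      rw [Finset.coe_filter] at hmem
      simp only [Set.mem_setOf_eq] at hmem
      obtain ⟨hE, hin⟩ := hmem
      have core : ∀ (j : Fin t) (u : Fin (3 * q + 1)), (∀ x ∈ s(u, succ P j u), x ∈ B) →
          seamColour (P k) s' u ≠ seamColour (P k) s' (succ P j u) := by
        intro j u hx
        by_cases hjk : j = k
        · rw [hjk] at hx ⊢
          show seamColour (P k) s' u ≠ seamColour (P k) s' ((P k).symm (P k u + 1))
          apply seamColour_own
          intro heq
          apply hs'
          have hu : u = (P k).symm (s' - 1) := by
            rw [Equiv.eq_symm_apply]; exact eq_sub_of_add_eq heq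
          have hsu : succ P k u = (P k).symm s' := by
            show (P k).symm (P k u + 1) = _; rw [heq]
          constructor
          · rw [← hu]; exact hx u (Sym2.mem_mk_left _ _)
          · rw [← hsu]; exact hx _ (Sym2.mem_mk_right _ _)
        · exact seamColour_foreign P hP (Ne.symm hjk) s' u
      intro hcol
      have hcol' := shift3_injective _ hcol
      simp only [edges, Finset.mem_biUnion, Finset.mem_univ, true_and, Finset.mem_image] at hE
      obtain ⟨j, u, hu⟩ := hE
      rcases Sym2.eq_iff.mp hu with ⟨rfl, rfl⟩ | ⟨rfl, rfl⟩
      · exact core j _ hin hcol'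
      · exact core j _ (by rwa [Sym2.eq_swap] at hin) hcol'.symm
    · intro v hv
      apply Fin.ext
      show ((seamColour (P k) s' v).val + (s' - s).val) % 3 = (seamColour (P k) s v).val
      exact (seamArcLemma_holds _ (P k) s s' v (hT v hv)).symm

end Summit.PneNP.PneNP.Cruxes.FoolingMeasure.IdeasR2g5
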